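import Summits.ValiantsHypothesis.ValiantsHypothesis.Theorems.HartogsRankTwoRectangleCriterion

/-!
# ValiantsHypothesis / HartogsRankTwo — item `RobustSparsity` (stmt-ValiantsHypothesis-10334), closed

Every polynomial `P` agreeing with `per_n` on the rank-`≤ 2` points `x_{ri} = Σ_{t<2} U_{rt} V_{it}` has
at least `C(n, ⌊n/2⌋)` monomials. (1) Torus grading: rank `≤ 2` is stable under `x_{ri} ↦ s_r t_i x_{ri}`,
so for `F := P - per_n` and a rank-`≤ 2` point `M` the polynomial `F(M_{ri} Y_r Z_i) ∈ ℂ[Y, Z]` vanishes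
identically (`MvPolynomial.funext`); its coefficient of `Y_1⋯Y_n Z_1⋯Z_n` is
`Σ_σ coeff_{m_σ}(F) Π_i M_{σ(i), i}`, the exponents of bidegree `(1ⁿ, 1ⁿ)` being exactly the permutation
patterns `m_σ = Σ_i e_{(σ i, i)}` (`exists_permExp_of_rowcol_one`). (2) Hence the generalized matrix
function with coefficients `coeff_{m_σ}(P) - 1` vanishes on the rank-`≤ 2` points and the route's
`RectangleCriterion` (item 10333, proved) gives `Σ_{σ : σ(A) = B} (coeff_{m_σ}(P) - 1) = 0` for `|A| = |B|`.
(3) Fix `|A| = ⌊n/2⌋`; for each `B` of that size some permutation maps `A` onto `B`, so some `σ_B` with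
`σ_B(A) = B` has `coeff_{m_{σ_B}}(P) ≠ 0`, and `B ↦ m_{σ_B}` is injective. HONEST FRAMING: an elementary
sparsity lemma (tight at `n = 3`), bookkeeping for a dormant route; nothing here is progress on `VP ≠ VNP`.
-/

-- layout Summits/ValiantsHypothesis/ValiantsHypothesis forces the duplicated namespace component
set_option linter.dupNamespace false

noncomputable section

namespace Summit.ValiantsHypothesis.ValiantsHypothesis.Theorems.HartogsRankTwo

open MvPolynomial

variable {n : ℕ}

/-- The exponent `m_σ = Σ_i e_{(σ i, i)}` of the monomial `Π_i X_{(σ i, i)}`. [folklore] -/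
def permExp (σ : Equiv.Perm (Fin n)) : (Fin n × Fin n) →₀ ℕ :=
  ∑ i, Finsupp.single (σ i, i) 1

/-- `m_σ (a, b) = [σ b = a]`. [folklore] -/
theorem permExp_apply (σ : Equiv.Perm (Fin n)) (a b : Fin n) :
    permExp σ (a, b) = if σ b = a then 1 else 0 := by
  rw [permExp, Finsupp.finsetSum_apply]
  simp only [Finsupp.single_apply, Prod.mk.injEq]
  rw [Finset.sum_eq_single b]
  · by_cases h : σ b = a <;> simp [h]
  · intro i _ hi
    rw [if_neg]
    exact fun h => hi h.2
  · intro h; exact absurd (Finset.mem_univ b) h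

/-- `Π_i X_{(σ i, i)} = monomial m_σ 1`. [folklore] -/
theorem prod_X_eq_monomial_permExp (σ : Equiv.Perm (Fin n)) :
    (∏ i : Fin n, X (σ i, i) : MvPolynomial (Fin n × Fin n) ℂ) = monomial (permExp σ) 1 := by
  rw [permExp, monomial_sum_index, C_1, one_mul]
  rfl

/-- `σ ↦ m_σ` is injective. [folklore] -/
theorem permExp_injective : Function.Injective (permExp (n := n)) := by
  intro σ τ h
  ext b
  have h1 := congrArg (fun m => m (τ b, b)) h
  simp only [permExp_apply, if_true] at h1
  by_cases hb : σ b = τ b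
  · exact congrArg Fin.val hb
  · rw [if_neg hb] at h1
    exact absurd h1 (by norm_num)

/-- Row sums of `m_σ` are `1`. [folklore] -/
theorem sum_permExp_row (σ : Equiv.Perm (Fin n)) (r : Fin n) : ∑ j, permExp σ (r, j) = 1 := by
  simp only [permExp_apply]
  rw [Finset.sum_eq_single (σ.symm r)]
  · simp
  · intro j _ hj
    rw [if_neg]
    intro h
    exact hj (by rw [← h, Equiv.symm_apply_apply])
  · intro h; exact absurd (Finset.mem_univ _) h

/-- Column sums of `m_σ` are `1`. [folklore] -/
theorem sum_permExp_col (σ : Equiv.Perm (Fin n)) (c : Fin n) : ∑ i, permExp σ (i, c) = 1 := by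
  simp only [permExp_apply]
  rw [Finset.sum_eq_single (σ c)]
  · simp
  · intro i _ hi
    rw [if_neg (Ne.symm hi)]
  · intro h; exact absurd (Finset.mem_univ _) h

/-- **Permutation patterns.** An exponent on `[n] × [n]` all of whose row sums and column sums are
`1` is `m_σ` for a (unique) permutation `σ`. [folklore] -/
theorem exists_permExp_of_rowcol_one (m : (Fin n × Fin n) →₀ ℕ)
    (hrow : ∀ r, ∑ j, m (r, j) = 1) (hcol : ∀ c, ∑ i, m (i, c) = 1) :
    ∃ σ : Equiv.Perm (Fin n), m = permExp σ := by
  classical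
  have hex : ∀ c, ∃ i, m (i, c) ≠ 0 := by
    intro c
    by_contra h
    push Not at h
    have := hcol c
    rw [Finset.sum_eq_zero (fun i _ => h i)] at this
    exact absurd this (by norm_num)
  choose f hf using hex
  have hcol' : ∀ c i i', m (i, c) ≠ 0 → m (i', c) ≠ 0 → i = i' := by
    intro c i i' hi hi'
    by_contra hne
    have h2 := Finset.add_le_sum (N := ℕ) (f := fun i => m (i, c)) (fun i _ => Nat.zero_le _)
      (Finset.mem_univ i) (Finset.mem_univ i') hne
    rw [hcol c] at h2
    omega
  have hrow' : ∀ r j j', m (r, j) ≠ 0 → m (r, j') ≠ 0 → j = j' := by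
    intro r j j' hj hj'
    by_contra hne
    have h2 := Finset.add_le_sum (N := ℕ) (f := fun j => m (r, j)) (fun j _ => Nat.zero_le _)
      (Finset.mem_univ j) (Finset.mem_univ j') hne
    rw [hrow r] at h2
    omega
  have hle : ∀ i c, m (i, c) ≤ 1 := by
    intro i c
    have := Finset.single_le_sum (f := fun i => m (i, c)) (fun i _ => Nat.zero_le _) (Finset.mem_univ i)
    rw [hcol c] at this
    exact this
  have hinj : Function.Injective f := fun c c' h => hrow' (f c) c c' (hf c) (by rw [h]; exact hf c')
  refine ⟨Equiv.ofBijective f (Finite.injective_iff_bijective.1 hinj), ?_⟩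
  ext ⟨a, b⟩
  rw [permExp_apply]
  simp only [Equiv.ofBijective_apply]
  by_cases h : f b = a
  · rw [if_pos h]
    have h1 := hf b
    rw [h] at h1
    have h2 := hle a b
    omega
  · rw [if_neg h]
    by_contra hne
    exact h (hcol' b (f b) a (hf b) hne)

/-- The weight `(row sums, column sums)` of an exponent, as an exponent on `[n] ⊕ [n]`.
[folklore] -/
def biWeight (m : (Fin n × Fin n) →₀ ℕ) : (Fin n ⊕ Fin n) →₀ ℕ :=
  ∑ ij ∈ m.support, (Finsupp.single (Sum.inl ij.1) (m ij) + Finsupp.single (Sum.inr ij.2) (m ij))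

/-- The weight `(1ⁿ, 1ⁿ)`. [folklore] -/
def unitBiWeight (n : ℕ) : (Fin n ⊕ Fin n) →₀ ℕ :=
  ∑ x : Fin n ⊕ Fin n, Finsupp.single x 1

/-- `unitBiWeight n x = 1`. [folklore] -/
theorem unitBiWeight_apply (x : Fin n ⊕ Fin n) : unitBiWeight n x = 1 := by
  rw [unitBiWeight, Finsupp.finsetSum_apply]
  simp [Finsupp.single_apply, Finset.sum_ite_eq']

/-- `biWeight m (inl r)` is the `r`-th row sum of `m`. [folklore] -/
theorem biWeight_apply_inl (m : (Fin n × Fin n) →₀ ℕ) (r : Fin n) :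
    biWeight m (Sum.inl r) = ∑ j, m (r, j) := by
  classical
  rw [biWeight, Finsupp.finsetSum_apply]
  simp only [Finsupp.add_apply, Finsupp.single_apply, reduceCtorEq, if_false, add_zero,
    Sum.inl.injEq]
  rw [Finset.sum_subset (Finset.subset_univ m.support) (fun ij _ hij => by
    rw [Finsupp.notMem_support_iff.1 hij]; simp)]
  rw [Fintype.sum_prod_type, Finset.sum_eq_single r]
  · simp
  · intro i _ hi
    simp [hi]
  · intro h; exact absurd (Finset.mem_univ r) h

/-- `biWeight m (inr c)` is the `c`-th column sum of `m`. [folklore] -/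
theorem biWeight_apply_inr (m : (Fin n × Fin n) →₀ ℕ) (c : Fin n) :
    biWeight m (Sum.inr c) = ∑ i, m (i, c) := by
  classical
  rw [biWeight, Finsupp.finsetSum_apply]
  simp only [Finsupp.add_apply, Finsupp.single_apply, reduceCtorEq, if_false, zero_add,
    Sum.inr.injEq]
  rw [Finset.sum_subset (Finset.subset_univ m.support) (fun ij _ hij => by
    rw [Finsupp.notMem_support_iff.1 hij]; simp)]
  rw [Fintype.sum_prod_type_right, Finset.sum_eq_single c]
  · simp
  · intro j _ hj
    simp [hj]
  · intro h; exact absurd (Finset.mem_univ c) h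

/-- An exponent of weight `(1ⁿ, 1ⁿ)` is a permutation pattern. [folklore] -/
theorem exists_permExp_of_biWeight_eq {m : (Fin n × Fin n) →₀ ℕ} (h : biWeight m = unitBiWeight n) :
    ∃ σ : Equiv.Perm (Fin n), m = permExp σ := by
  refine exists_permExp_of_rowcol_one m (fun r => ?_) (fun c => ?_)
  · rw [← biWeight_apply_inl, h, unitBiWeight_apply]
  · rw [← biWeight_apply_inr, h, unitBiWeight_apply]

/-- Permutation patterns have weight `(1ⁿ, 1ⁿ)`. [folklore] -/
theorem biWeight_permExp (σ : Equiv.Perm (Fin n)) : biWeight (permExp σ) = unitBiWeight n := by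
  ext x
  rw [unitBiWeight_apply]
  cases x with
  | inl r => rw [biWeight_apply_inl, sum_permExp_row]
  | inr c => rw [biWeight_apply_inr, sum_permExp_col]

/-- The torus substitution `X_{ri} ↦ M_{ri} · Y_r · Z_i` into the variables `Y = inl`, `Z = inr`.
[folklore] -/
def torusSubst (M : Fin n × Fin n → ℂ) : Fin n × Fin n → MvPolynomial (Fin n ⊕ Fin n) ℂ :=
  fun ij => C (M ij) * X (Sum.inl ij.1) * X (Sum.inr ij.2)

/-- The torus substitution sends `monomial m 1` to `C(M^m) · monomial (biWeight m) 1`. [folklore] -/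
theorem aeval_torusSubst_monomial (M : Fin n × Fin n → ℂ) (m : (Fin n × Fin n) →₀ ℕ) :
    aeval (torusSubst M) (monomial m (1 : ℂ)) = C (eval M (monomial m 1)) * monomial (biWeight m) 1 := by
  rw [aeval_monomial, eval_monomial, map_one, one_mul, one_mul]
  simp only [Finsupp.prod]
  rw [biWeight, monomial_sum_index, C_1, one_mul, map_prod, ← Finset.prod_mul_distrib]
  refine Finset.prod_congr rfl fun ij _ => ?_
  rw [torusSubst, mul_pow, mul_pow, ← map_pow, X_pow_eq_monomial, X_pow_eq_monomial, mul_assoc,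
    monomial_mul, mul_one]

/-- Evaluating the torus substitution at a point `x` of `ℂ^{[n] ⊔ [n]}`. [folklore] -/
theorem eval_torusSubst (M : Fin n × Fin n → ℂ) (x : Fin n ⊕ Fin n → ℂ) (ij : Fin n × Fin n) :
    eval x (torusSubst M ij) = x (Sum.inl ij.1) * x (Sum.inr ij.2) * M ij := by
  rw [torusSubst]
  simp only [map_mul, eval_C, eval_X]
  ring

/-- **Coefficient extraction.** The coefficient of `Y_1⋯Y_n Z_1⋯Z_n` in `F(M_{ri} Y_r Z_i)` is the
generalized-matrix-function part of `F` evaluated at `M`: `Σ_σ coeff_{m_σ}(F) · Π_i M_{σ(i), i}`.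
[folklore] -/
theorem coeff_unitBiWeight_aeval_torusSubst (M : Fin n × Fin n → ℂ) (F : MvPolynomial (Fin n × Fin n) ℂ) :
    coeff (unitBiWeight n) (aeval (torusSubst M) F) =
      ∑ σ : Equiv.Perm (Fin n), coeff (permExp σ) F * ∏ i, M (σ i, i) := by
  classical
  conv_lhs => rw [F.as_sum]
  simp only [map_sum, coeff_sum]
  have hterm : ∀ m ∈ F.support,
      coeff (unitBiWeight n) (aeval (torusSubst M) (monomial m (coeff m F))) =
      if biWeight m = unitBiWeight n then coeff m F * eval M (monomial m 1) else 0 := by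
    intro m _
    have h1 := aeval_torusSubst_monomial M m
    have h2 : monomial m (coeff m F) = C (coeff m F) * monomial m 1 := by
      rw [C_mul_monomial, mul_one]
    have hx : aeval (torusSubst M) (monomial m (coeff m F)) =
        C (coeff m F * eval M (monomial m 1)) * monomial (biWeight m) 1 := by
      calc aeval (torusSubst M) (monomial m (coeff m F))
          = aeval (torusSubst M) (C (coeff m F) * monomial m 1) := by rw [h2]
        _ = C (coeff m F) * aeval (torusSubst M) (monomial m (1 : ℂ)) := by
            rw [map_mul, aeval_C, MvPolynomial.algebraMap_eq]
        _ = C (coeff m F) * (C (eval M (monomial m 1)) * monomial (biWeight m) 1) := by rw [h1]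
        _ = C (coeff m F * eval M (monomial m 1)) * monomial (biWeight m) 1 := by
            rw [map_mul, mul_assoc]
    rw [hx, coeff_C_mul, coeff_monomial]
    by_cases h : biWeight m = unitBiWeight n
    · rw [if_pos h, if_pos h, mul_one]
    · rw [if_neg h, if_neg h, mul_zero]
  rw [Finset.sum_congr rfl hterm, ← Finset.sum_filter]
  symm
  rw [← Finset.sum_subset (Finset.subset_univ (Finset.univ.filter fun σ : Equiv.Perm (Fin n) =>
      permExp σ ∈ F.support)) (fun σ _ hσ => by
        rw [Finset.mem_filter, not_and] at hσ
        rw [notMem_support_iff.1 (hσ (Finset.mem_univ σ)), zero_mul])]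
  refine Finset.sum_nbij permExp ?_ ?_ ?_ ?_
  · intro σ hσ
    rw [Finset.mem_filter] at hσ
    exact Finset.mem_filter.2 ⟨hσ.2, biWeight_permExp σ⟩
  · exact fun σ _ τ _ h => permExp_injective h
  · intro m hm
    rw [Finset.coe_filter, Set.mem_setOf_eq] at hm
    obtain ⟨σ, rfl⟩ := exists_permExp_of_biWeight_eq hm.2
    exact ⟨σ, by rw [Finset.coe_filter, Set.mem_setOf_eq]; exact ⟨Finset.mem_univ _, hm.1⟩, rfl⟩
  · intro σ _
    rw [← prod_X_eq_monomial_permExp, map_prod]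
    simp only [eval_X]

/-- **Torus-stable vanishing kills the `(1ⁿ, 1ⁿ)` part.** If `F` vanishes at `(s_r t_i M_{ri})` for all
`s, t`, then `Σ_σ coeff_{m_σ}(F) Π_i M_{σ(i), i} = 0`. [folklore] -/
theorem gmfPart_eval_eq_zero (M : Fin n × Fin n → ℂ) (F : MvPolynomial (Fin n × Fin n) ℂ)
    (h : ∀ s t : Fin n → ℂ, eval (fun ij : Fin n × Fin n => s ij.1 * t ij.2 * M ij) F = 0) :
    ∑ σ : Equiv.Perm (Fin n), coeff (permExp σ) F * ∏ i, M (σ i, i) = 0 := by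
  rw [← coeff_unitBiWeight_aeval_torusSubst]
  have hΦ : aeval (torusSubst M) F = 0 := by
    refine MvPolynomial.funext fun x => ?_
    rw [map_zero]
    have h1 := h (fun r => x (Sum.inl r)) (fun i => x (Sum.inr i))
    have hfun : (fun ij : Fin n × Fin n => eval₂Hom (RingHom.id ℂ) x (torusSubst M ij)) =
        fun ij : Fin n × Fin n => x (Sum.inl ij.1) * x (Sum.inr ij.2) * M ij := by
      funext ij
      exact eval_torusSubst M x ij
    change eval₂Hom (RingHom.id ℂ) x (bind₁ (torusSubst M) F) = _
    rw [eval₂Hom_bind₁, hfun]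
    exact h1
  rw [hΦ, coeff_zero]

/-- There is a permutation of `Fin n` mapping `A` onto `B` when `|A| = |B|`. [folklore] -/
theorem exists_perm_map_eq (A B : Finset (Fin n)) (h : A.card = B.card) :
    ∃ σ : Equiv.Perm (Fin n), A.map σ.toEmbedding = B := by
  classical
  have hc : Fintype.card {x // x ∈ A} = Fintype.card {x // x ∈ B} := by simp [h]
  let e : {x // x ∈ A} ≃ {x // x ∈ B} := Fintype.equivOfCardEq hc
  refine ⟨e.extendSubtype, ?_⟩
  apply Finset.eq_of_subset_of_card_le
  · intro y hy
    rw [Finset.mem_map_equiv] at hy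
    have : e.extendSubtype (e.extendSubtype.symm y) ∈ B :=
      Equiv.extendSubtype_mem e _ hy
    rwa [Equiv.apply_symm_apply] at this
  · rw [Finset.card_map, h]

/-- `coeff m_σ per_n = 1`. [folklore] -/
theorem coeff_permExp_perPoly (σ : Equiv.Perm (Fin n)) :
    coeff (permExp σ) (Literature.Computability.AlgebraicComplexity.perPoly (Fin n) ℂ) = 1 := by
  rw [Literature.Computability.AlgebraicComplexity.perPoly, Matrix.permanent]
  simp only [Matrix.mvPolynomialX_apply, coeff_sum]
  simp_rw [prod_X_eq_monomial_permExp, coeff_monomial]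
  rw [Finset.sum_eq_single σ]
  · rw [if_pos rfl]
  · intro τ _ hτ
    rw [if_neg (fun h => hτ (permExp_injective h))]
  · intro h; exact absurd (Finset.mem_univ σ) h

/-- Evaluation of a generalized matrix function at a point. [folklore] -/
theorem eval_gmf' (q : Equiv.Perm (Fin n) → ℂ) (pt : Fin n × Fin n → ℂ) :
    eval pt (∑ σ : Equiv.Perm (Fin n), C (q σ) * ∏ i : Fin n, X (σ i, i)) =
      ∑ σ : Equiv.Perm (Fin n), q σ * ∏ i, pt (σ i, i) := by
  simp only [map_sum, map_mul, eval_C, map_prod, eval_X]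

/-- **Steps 1–2.** If `P` agrees with `per_n` on the rank-`≤ 2` points, then the generalized matrix
function with coefficients `coeff_{m_σ}(P) - 1` vanishes on the rank-`≤ 2` points. [folklore] -/
theorem gmf_sub_one_vanishes (P : MvPolynomial (Fin n × Fin n) ℂ)
    (hP : ∀ U V : Fin n → Fin 2 → ℂ,
      eval (fun ij : Fin n × Fin n => ∑ t : Fin 2, U ij.1 t * V ij.2 t) P =
        eval (fun ij : Fin n × Fin n => ∑ t : Fin 2, U ij.1 t * V ij.2 t)
          (Literature.Computability.AlgebraicComplexity.perPoly (Fin n) ℂ))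
    (U V : Fin n → Fin 2 → ℂ) :
    eval (fun ij : Fin n × Fin n => ∑ t : Fin 2, U ij.1 t * V ij.2 t)
      (∑ σ : Equiv.Perm (Fin n), C (coeff (permExp σ) P - 1) * ∏ i : Fin n, X (σ i, i)) = 0 := by
  set M : Fin n × Fin n → ℂ := fun ij => ∑ t : Fin 2, U ij.1 t * V ij.2 t with hM
  rw [eval_gmf']
  have hcoeff : ∀ σ : Equiv.Perm (Fin n), coeff (permExp σ) P - 1 =
      coeff (permExp σ) (P - Literature.Computability.AlgebraicComplexity.perPoly (Fin n) ℂ) := by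
    intro σ
    rw [coeff_sub, coeff_permExp_perPoly]
  simp_rw [hcoeff]
  refine gmfPart_eval_eq_zero M (P - Literature.Computability.AlgebraicComplexity.perPoly (Fin n) ℂ)
    fun s t => ?_
  -- the scaled point is again of rank ≤ 2: `(s • U) (t • V)ᵀ`
  have hpt : (fun ij : Fin n × Fin n => s ij.1 * t ij.2 * M ij) =
      fun ij : Fin n × Fin n => ∑ c : Fin 2, (s ij.1 * U ij.1 c) * (t ij.2 * V ij.2 c) := by
    funext ij
    rw [hM, Finset.mul_sum]
    refine Finset.sum_congr rfl fun c _ => ?_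
    ring
  have h2 : eval (fun ij : Fin n × Fin n => ∑ c : Fin 2, (s ij.1 * U ij.1 c) * (t ij.2 * V ij.2 c)) P =
      eval (fun ij : Fin n × Fin n => ∑ c : Fin 2, (s ij.1 * U ij.1 c) * (t ij.2 * V ij.2 c))
        (Literature.Computability.AlgebraicComplexity.perPoly (Fin n) ℂ) :=
    hP (fun r c => s r * U r c) (fun i c => t i * V i c)
  rw [hpt, map_sub, h2, sub_self]

/-- **Item `RobustSparsity` (stmt-ValiantsHypothesis-10334).** Every polynomial agreeing with
`per_n` on the rank-`≤ 2` points has at least `C(n, ⌊n/2⌋)` monomials: torus grading + the route's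
`RectangleCriterion` + one permutation per `⌊n/2⌋`-set. [folklore] -/
theorem robustSparsity_proof : Theses.HartogsRankTwo.RobustSparsity := by
  classical
  unfold Theses.HartogsRankTwo.RobustSparsity
  intro n P hP
  -- RectangleCriterion (item 10333, proved) applied to the coefficients `coeff m_σ P - 1`
  have hRC := rectangleCriterion_proof
  unfold Theses.HartogsRankTwo.RectangleCriterion at hRC
  have hrect := (hRC n (fun σ => coeff (permExp σ) P - 1)).1 (gmf_sub_one_vanishes P hP)
  obtain ⟨A, -, hA⟩ := Finset.exists_subset_card_eq (s := (Finset.univ : Finset (Fin n)))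
    (n := n / 2) (by rw [Finset.card_univ, Fintype.card_fin]; exact Nat.div_le_self n 2)
  -- for each `B` of size `n/2`, a permutation `σ_B` with `σ_B(A) = B` and `coeff m_{σ_B} P ≠ 0`
  have hB : ∀ B ∈ Finset.powersetCard (n / 2) (Finset.univ : Finset (Fin n)),
      ∃ σ : Equiv.Perm (Fin n), A.map σ.toEmbedding = B ∧ coeff (permExp σ) P ≠ 0 := by
    intro B hB
    rw [Finset.mem_powersetCard] at hB
    have hAB : A.card = B.card := by rw [hA, hB.2]
    have hsum := hrect A B hAB
    rw [Finset.sum_sub_distrib, sub_eq_zero, Finset.sum_const, nsmul_eq_mul, mul_one] at hsum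
    by_contra hcon
    have h0 : ∑ σ ∈ Finset.univ.filter (fun σ : Equiv.Perm (Fin n) => A.map σ.toEmbedding = B),
        coeff (permExp σ) P = 0 := by
      refine Finset.sum_eq_zero fun σ hσ => ?_
      by_contra hne
      exact hcon ⟨σ, (Finset.mem_filter.1 hσ).2, hne⟩
    rw [h0] at hsum
    obtain ⟨σ₀, hσ₀⟩ := exists_perm_map_eq A B hAB
    have hpos : 0 < (Finset.univ.filter (fun σ : Equiv.Perm (Fin n) => A.map σ.toEmbedding = B)).card :=
      Finset.card_pos.2 ⟨σ₀, Finset.mem_filter.2 ⟨Finset.mem_univ _, hσ₀⟩⟩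
    have hne : ((Finset.univ.filter
        (fun σ : Equiv.Perm (Fin n) => A.map σ.toEmbedding = B)).card : ℂ) ≠ 0 :=
      Nat.cast_ne_zero.2 hpos.ne'
    exact hne hsum.symm
  choose σB hσB hqB using hB
  -- the injection `B ↦ m_{σ_B}` into the support of `P`
  have hinj : (Finset.powersetCard (n / 2) (Finset.univ : Finset (Fin n))).card ≤ P.support.card := by
    refine Finset.card_le_card_of_injOn
      (fun B => if h : B ∈ Finset.powersetCard (n / 2) (Finset.univ : Finset (Fin n))
        then permExp (σB B h) else 0) (fun B hB => ?_) ?_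
    · have hB' : B ∈ Finset.powersetCard (n / 2) (Finset.univ : Finset (Fin n)) := hB
      simp only [dif_pos hB']
      exact mem_support_iff.2 (hqB B hB')
    · intro B hB B' hB' h
      rw [Finset.mem_coe] at hB hB'
      simp only [dif_pos hB, dif_pos hB'] at h
      have hστ : σB B hB = σB B' hB' := permExp_injective h
      rw [← hσB B hB, ← hσB B' hB', hστ]
  rw [Finset.card_powersetCard, Finset.card_univ, Fintype.card_fin] at hinj
  exact hinj

end Summit.ValiantsHypothesis.ValiantsHypothesis.Theorems.HartogsRankTwo

end
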